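import Summits.QuantumFields.YangMills.Theorems.PoincareLipschitzConeLinkChartRegion
import Literature.Analysis.FunctionSpaces.SobolevDomain
import HarnessLib


/-!
# Crux `BlockLipschitzL` (stmt-QuantumFields-23533) ∕ `HistoryTailL` (stmt-QuantumFields-19936), LINE 25 «CompactnessTransfer»,
# stub S1″ — ROAD (H) «SU(2) currents ⇒ H-system ⇒ 8π quantum», brick (T) «CONE → PLANE TRANSPORT», FILE D1 «CONE CUT-OFFS»

Cell `ym3-torus` (YM ladder rung R3 = continuum SU(2) Yang–Mills on T³ — a RUNG, NOT Clay: not d = 4, not infinite volume,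
not a mass gap); WIDTH helper seat `ym3-torus-px14` g7 (brick (T) of px19 g8's ROAD (H), architecture v1; chart letters A1∕A2 by
px16 g10).  Helper `--supports stmt-QuantumFields-23533`; THEOREMS ONLY (0 `def`, 0 `sorry`, default heartbeats); imports
px16 g10's ✓`PoincareLipschitzConeLinkChart` (inverse stereographic projection `σ`, conformal factor `c`) and
✓`PoincareLipschitzConeLinkChartRegion` (the chart region `V = {0 < ‖x‖ + x₂}`, the angular inverse `π`), lit ✓`SobolevDomain`
(`IsTestFunctionOn`), Mathlib.

WHAT THIS FILE PROVES.  The 3-d test functions of the transport are CONE CUT-OFFS: for `χ ∈ C^∞(ℝ)` supported in `[a,b]`,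
`0 < a`, `φ ∈ C_c^∞(E²)` and `g` smooth on `V`, the zero extension `ζ := V.indicator (x ↦ (χ ‖x‖ · φ (π x)) • g x)` is `C^∞` on
ALL of `E³` with `tsupport ζ ⊆ B̄_b(0)` (★★ `contDiff_coneCutoff`, `tsupport_coneCutoff_subset`): on `V` it is smooth; off `V`
(the closed ray `{x₀ = x₁ = 0, x₂ ≤ 0}`) it vanishes identically NEAR every point — near the origin because `χ(‖x‖) = 0` for
`‖x‖ < a`, near a ray point `x₀ ≠ 0` because `‖π x‖² = (‖x‖ − x₂)∕(‖x‖ + x₂) → ∞` (★ `norm_pi_sq`, ★ `eventually_norm_pi_gt`)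
so `φ (π x) = 0` there.  On the cone: `ζ (t • σ y) = (χ t · φ y) • g (t • σ y)` (`coneCutoff_smul_sigma`), whence the pull-back
`y ↦ ζ (t • σ y)` and its `y`-derivative (`fderiv_comp_smul_sigma`: `D(θ ∘ (t•σ))_y v = Dθ_{tσy}(t • Dσ_y v)` for any `C¹` `θ`).

HONEST SCOPE.  Calculus; nothing of (GAP)∕(TM), (C), S1″, K1, `MeanDeviationL`, `BlockLipschitzL`, `HistoryTailL` is proved
here.  YM₃ on T³ is rung R3, not Clay; YM gap NOT proved; no summit statement is proved here.

References: L. Simon, Theorems on Regularity and Singularity of Energy Minimizing Maps (1996) [Simon1996] (§3.1); L. C. Evans,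
Partial Differential Equations, 2nd ed. (2010) [Evans2010] (§5.2.1, App. C).
-/

set_option autoImplicit false

noncomputable section

open MeasureTheory Set Function Filter Topology Metric
open scoped RealInnerProductSpace BigOperators ContDiff

namespace Summit.QuantumFields.YangMills.Theorems.PoincareLipschitzConeLinkCutoff

open Literature.Analysis.FunctionSpaces (IsTestFunctionOn)
open Summit.QuantumFields.YangMills.Theorems.PoincareLipschitzConeLinkChart

variable {c : EuclideanSpace ℝ (Fin 2) → ℝ} {σ : EuclideanSpace ℝ (Fin 2) → EuclideanSpace ℝ (Fin 3)}
  {π : EuclideanSpace ℝ (Fin 3) → EuclideanSpace ℝ (Fin 2)}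
variable {W : Type*} [NormedAddCommGroup W] [NormedSpace ℝ W]

/-! ## §1 The angular inverse blows up at the ray -/

omit [NormedSpace ℝ W] in
/-- Coordinates: `‖!₂[x₀, x₁]‖² = ‖x‖² − x₂²` for `x ∈ E³`. [folklore] -/
theorem norm_sq_horizontal (x : EuclideanSpace ℝ (Fin 3)) :
    ‖(!₂[x 0, x 1] : EuclideanSpace ℝ (Fin 2))‖ ^ 2 = ‖x‖ ^ 2 - x 2 ^ 2 := by
  rw [EuclideanSpace.norm_sq_eq, EuclideanSpace.norm_sq_eq, Fin.sum_univ_two, Fin.sum_univ_three]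
  simp only [Real.norm_eq_abs, sq_abs, Matrix.cons_val_zero, Matrix.cons_val_one]
  ring

/-- ★ **THE ANGULAR INVERSE IN TERMS OF `‖x‖ ± x₂`**: on `V`, `‖π x‖² = (‖x‖ − x₂)∕(‖x‖ + x₂)`. [folklore] -/
theorem norm_pi_sq (hπ : ∀ x, π x = (‖x‖ + x 2)⁻¹ • !₂[x 0, x 1]) {x : EuclideanSpace ℝ (Fin 3)}
    (hx : 0 < ‖x‖ + x 2) : ‖π x‖ ^ 2 = (‖x‖ - x 2) / (‖x‖ + x 2) := by
  rw [hπ x, norm_smul, mul_pow, norm_inv, Real.norm_eq_abs, abs_of_pos hx, norm_sq_horizontal,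
    show ‖x‖ ^ 2 - x 2 ^ 2 = (‖x‖ - x 2) * (‖x‖ + x 2) by ring]
  field_simp

/-- ★ **ESCAPE NEAR THE RAY.**  At a point `x₀ ≠ 0` off `V` (so on the ray `x₀ = (0,0,−s)`), for every `M`: eventually near
`x₀`, every point of `V` has `M < ‖π x‖`. [folklore] -/
theorem eventually_norm_pi_gt (hπ : ∀ x, π x = (‖x‖ + x 2)⁻¹ • !₂[x 0, x 1]) {x₀ : EuclideanSpace ℝ (Fin 3)}
    (hx₀ : ¬ 0 < ‖x₀‖ + x₀ 2) (hx₀0 : x₀ ≠ 0) (M : ℝ) :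
    ∀ᶠ x in 𝓝 x₀, 0 < ‖x‖ + x 2 → M < ‖π x‖ := by
  -- the open set `O = {M₊² (‖x‖ + x₂) < ‖x‖ − x₂}` contains `x₀`
  set M' := max M 0 with hM'
  have hO : IsOpen {x : EuclideanSpace ℝ (Fin 3) | M' ^ 2 * (‖x‖ + x 2) < ‖x‖ - x 2} := by
    have h2c : Continuous fun x : EuclideanSpace ℝ (Fin 3) => x 2 := (EuclideanSpace.proj (2 : Fin 3)).continuous
    have h1 : Continuous fun x : EuclideanSpace ℝ (Fin 3) => M' ^ 2 * (‖x‖ + x 2) :=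
      continuous_const.mul (continuous_norm.add h2c)
    have h2 : Continuous fun x : EuclideanSpace ℝ (Fin 3) => ‖x‖ - x 2 := continuous_norm.sub h2c
    exact isOpen_lt h1 h2
  have hx₀O : x₀ ∈ {x : EuclideanSpace ℝ (Fin 3) | M' ^ 2 * (‖x‖ + x 2) < ‖x‖ - x 2} := by
    have h1 : ‖x₀‖ + x₀ 2 ≤ 0 := not_lt.1 hx₀
    have h2 : 0 < ‖x₀‖ := norm_pos_iff.2 hx₀0
    have h3 : ‖x₀‖ - x₀ 2 > 0 := by linarith
    show M' ^ 2 * (‖x₀‖ + x₀ 2) < ‖x₀‖ - x₀ 2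
    nlinarith [sq_nonneg M']
  filter_upwards [hO.mem_nhds hx₀O] with x hx hxV
  have hsq : ‖π x‖ ^ 2 = (‖x‖ - x 2) / (‖x‖ + x 2) := norm_pi_sq hπ hxV
  have h1 : M' ^ 2 < ‖π x‖ ^ 2 := by
    rw [hsq, lt_div_iff₀ hxV]
    exact hx
  have hM'0 : 0 ≤ M' := le_max_right _ _
  calc M ≤ M' := le_max_left _ _
    _ < ‖π x‖ := by
      by_contra h
      push Not at h
      have : ‖π x‖ ^ 2 ≤ M' ^ 2 := pow_le_pow_left₀ (norm_nonneg _) h 2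
      linarith

/-! ## §2 Smooth extension by zero across the ray -/

/-- ★★ **CONE CUT-OFFS ARE SMOOTH ON `E³`.**  If `F` is smooth on `V`, vanishes at the points of `V` of norm `< a` (`a > 0`) and
at the points of `V` with `‖π x‖ > M`, then its zero extension `V.indicator F` is `C^∞` on `E³`. [folklore] -/
theorem contDiff_indicator_of_cone_vanishing (hπ : ∀ x, π x = (‖x‖ + x 2)⁻¹ • !₂[x 0, x 1])
    {F : EuclideanSpace ℝ (Fin 3) → W} (hF : ContDiffOn ℝ ∞ F {x : EuclideanSpace ℝ (Fin 3) | 0 < ‖x‖ + x 2})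
    {a M : ℝ} (ha : 0 < a) (hFa : ∀ x : EuclideanSpace ℝ (Fin 3), 0 < ‖x‖ + x 2 → ‖x‖ < a → F x = 0)
    (hFM : ∀ x : EuclideanSpace ℝ (Fin 3), 0 < ‖x‖ + x 2 → M < ‖π x‖ → F x = 0) :
    ContDiff ℝ ∞ ({x : EuclideanSpace ℝ (Fin 3) | 0 < ‖x‖ + x 2}.indicator F) := by
  rw [contDiff_iff_contDiffAt]
  intro x
  by_cases hx : 0 < ‖x‖ + x 2
  · -- on `V`: the indicator is `F` near `x`
    have hV : {x : EuclideanSpace ℝ (Fin 3) | 0 < ‖x‖ + x 2} ∈ 𝓝 x := isOpen_V.mem_nhds hx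
    refine (hF.contDiffAt hV).congr_of_eventuallyEq ?_
    filter_upwards [hV] with x' hx'
    exact indicator_of_mem (show x' ∈ {x : EuclideanSpace ℝ (Fin 3) | 0 < ‖x‖ + x 2} from hx') F
  · -- off `V`: the indicator vanishes near `x`
    refine (contDiffAt_const (c := (0 : W))).congr_of_eventuallyEq ?_
    by_cases hx0 : x = 0
    · subst hx0
      filter_upwards [Metric.ball_mem_nhds (0 : EuclideanSpace ℝ (Fin 3)) ha] with x' hx'
      by_cases hx'V : 0 < ‖x'‖ + x' 2
      · rw [indicator_of_mem (show x' ∈ {x : EuclideanSpace ℝ (Fin 3) | 0 < ‖x‖ + x 2} from hx'V)]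
        exact hFa x' hx'V (by simpa using hx')
      · exact indicator_of_notMem (show x' ∉ {x : EuclideanSpace ℝ (Fin 3) | 0 < ‖x‖ + x 2} from hx'V) F
    · filter_upwards [eventually_norm_pi_gt hπ hx hx0 M] with x' hx'
      by_cases hx'V : 0 < ‖x'‖ + x' 2
      · rw [indicator_of_mem (show x' ∈ {x : EuclideanSpace ℝ (Fin 3) | 0 < ‖x‖ + x 2} from hx'V)]
        exact hFM x' hx'V (hx' hx'V)
      · exact indicator_of_notMem (show x' ∉ {x : EuclideanSpace ℝ (Fin 3) | 0 < ‖x‖ + x 2} from hx'V) F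

omit [NormedSpace ℝ W] in
/-- **Support of a cone cut-off.**  If `F` vanishes at the points of `V` of norm `> b`, then
`tsupport (V.indicator F) ⊆ B̄_b(0)`, and the zero extension has compact support. [folklore] -/
theorem tsupport_indicator_subset_closedBall {F : EuclideanSpace ℝ (Fin 3) → W} {b : ℝ}
    (hFb : ∀ x : EuclideanSpace ℝ (Fin 3), 0 < ‖x‖ + x 2 → b < ‖x‖ → F x = 0) :
    tsupport ({x : EuclideanSpace ℝ (Fin 3) | 0 < ‖x‖ + x 2}.indicator F) ⊆ closedBall 0 b := by
  refine closure_minimal (fun x hx => ?_) isClosed_closedBall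
  rw [mem_closedBall, dist_zero_right]
  by_contra h
  push Not at h
  apply hx
  by_cases hxV : 0 < ‖x‖ + x 2
  · rw [indicator_of_mem (show x ∈ {x : EuclideanSpace ℝ (Fin 3) | 0 < ‖x‖ + x 2} from hxV)]
    exact hFb x hxV h
  · exact indicator_of_notMem (show x ∉ {x : EuclideanSpace ℝ (Fin 3) | 0 < ‖x‖ + x 2} from hxV) F

omit [NormedSpace ℝ W] in
/-- Compact support of a cone cut-off. [folklore] -/
theorem hasCompactSupport_indicator {F : EuclideanSpace ℝ (Fin 3) → W} {b : ℝ}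
    (hFb : ∀ x : EuclideanSpace ℝ (Fin 3), 0 < ‖x‖ + x 2 → b < ‖x‖ → F x = 0) :
    HasCompactSupport ({x : EuclideanSpace ℝ (Fin 3) | 0 < ‖x‖ + x 2}.indicator F) :=
  IsCompact.of_isClosed_subset (isCompact_closedBall 0 b) (isClosed_tsupport _)
    (tsupport_indicator_subset_closedBall hFb)

/-! ## §3 The standard cone cut-off `(χ ‖x‖ · φ (π x)) • g x` -/

/-- **Smoothness on `V` of the standard cut-off.** [folklore] -/
theorem contDiffOn_coneCutoff (hπ : ∀ x, π x = (‖x‖ + x 2)⁻¹ • !₂[x 0, x 1])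
    {χ : ℝ → ℝ} (hχ : ContDiff ℝ ∞ χ) {φ : EuclideanSpace ℝ (Fin 2) → ℝ} (hφ : ContDiff ℝ ∞ φ)
    {g : EuclideanSpace ℝ (Fin 3) → W} (hg : ContDiffOn ℝ ∞ g {x : EuclideanSpace ℝ (Fin 3) | 0 < ‖x‖ + x 2}) :
    ContDiffOn ℝ ∞ (fun x => (χ ‖x‖ * φ (π x)) • g x) {x : EuclideanSpace ℝ (Fin 3) | 0 < ‖x‖ + x 2} := by
  have hV0 : ∀ x ∈ {x : EuclideanSpace ℝ (Fin 3) | 0 < ‖x‖ + x 2}, x ≠ 0 := by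
    rintro x hx rfl
    simp at hx
  have h1 : ContDiffOn ℝ ∞ (fun x : EuclideanSpace ℝ (Fin 3) => χ ‖x‖) {x | 0 < ‖x‖ + x 2} :=
    hχ.comp_contDiffOn (contDiffOn_id.norm ℝ hV0)
  have h2 : ContDiffOn ℝ ∞ (fun x => φ (π x)) {x : EuclideanSpace ℝ (Fin 3) | 0 < ‖x‖ + x 2} :=
    hφ.comp_contDiffOn (contDiffOn_pi hπ)
  exact (h1.mul h2).smul hg

/-- **Vanishing pattern of the standard cut-off**: it vanishes where `χ ‖x‖ = 0` or `φ (π x) = 0` — in particular at the points of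
`V` of norm `< a` or `> b` when `tsupport χ ⊆ [a,b]`, and at those with `‖π x‖ > M` when `tsupport φ ⊆ B̄_M(0)`. [folklore] -/
theorem coneCutoff_eq_zero_of {χ : ℝ → ℝ} {a b : ℝ} (hχs : tsupport χ ⊆ Icc a b)
    {φ : EuclideanSpace ℝ (Fin 2) → ℝ} {M : ℝ} (hφs : tsupport φ ⊆ closedBall 0 M)
    (g : EuclideanSpace ℝ (Fin 3) → W) (x : EuclideanSpace ℝ (Fin 3)) :
    (‖x‖ < a → (χ ‖x‖ * φ (π x)) • g x = 0) ∧ (b < ‖x‖ → (χ ‖x‖ * φ (π x)) • g x = 0) ∧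
      (M < ‖π x‖ → (χ ‖x‖ * φ (π x)) • g x = 0) := by
  have hχ0 : ∀ r : ℝ, r ∉ Icc a b → χ r = 0 := fun r hr => image_eq_zero_of_notMem_tsupport fun h => hr (hχs h)
  have hφ0 : ∀ y : EuclideanSpace ℝ (Fin 2), M < ‖y‖ → φ y = 0 := fun y hy =>
    image_eq_zero_of_notMem_tsupport fun h => by
      have := hφs h
      rw [mem_closedBall, dist_zero_right] at this
      linarith
  refine ⟨fun h => ?_, fun h => ?_, fun h => ?_⟩
  · rw [hχ0 _ (fun hm => by linarith [hm.1]), zero_mul, zero_smul]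
  · rw [hχ0 _ (fun hm => by linarith [hm.2]), zero_mul, zero_smul]
  · rw [hφ0 _ h, mul_zero, zero_smul]

/-- ★★ **THE STANDARD CONE CUT-OFF IS A TEST FUNCTION.**  For `χ ∈ C^∞(ℝ)` with `tsupport χ ⊆ [a,b]`, `0 < a`, `φ ∈ C_c^∞(E²)`
and `g` smooth on `V`: `ζ := V.indicator ((χ ‖x‖ · φ (π x)) • g x)` is `C^∞` on `E³`, compactly supported, with
`tsupport ζ ⊆ B̄_b(0)`; hence a test function on every open `Ω ⊇ B̄_b(0)`. [cite: Evans2010, §5.2.1] -/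
theorem isTestFunctionOn_coneCutoff (hπ : ∀ x, π x = (‖x‖ + x 2)⁻¹ • !₂[x 0, x 1])
    {χ : ℝ → ℝ} (hχ : ContDiff ℝ ∞ χ) {a b : ℝ} (ha : 0 < a) (hχs : tsupport χ ⊆ Icc a b)
    {φ : EuclideanSpace ℝ (Fin 2) → ℝ} (hφ : ContDiff ℝ ∞ φ) (hφc : HasCompactSupport φ)
    {g : EuclideanSpace ℝ (Fin 3) → W} (hg : ContDiffOn ℝ ∞ g {x : EuclideanSpace ℝ (Fin 3) | 0 < ‖x‖ + x 2})
    {Ω : TopologicalSpace.Opens (EuclideanSpace ℝ (Fin 3))} (hΩ : closedBall (0 : EuclideanSpace ℝ (Fin 3)) b ⊆ Ω) :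
    IsTestFunctionOn Ω ({x : EuclideanSpace ℝ (Fin 3) | 0 < ‖x‖ + x 2}.indicator fun x => (χ ‖x‖ * φ (π x)) • g x) := by
  obtain ⟨M, hM⟩ := hφc.isCompact.isBounded.subset_closedBall (0 : EuclideanSpace ℝ (Fin 2))
  have hz := fun x => coneCutoff_eq_zero_of (π := π) hχs hM g x
  refine ⟨contDiff_indicator_of_cone_vanishing hπ (contDiffOn_coneCutoff hπ hχ hφ hg) ha
      (fun x _ hx => (hz x).1 hx) (fun x _ hx => (hz x).2.2 hx),
    hasCompactSupport_indicator (fun x _ hx => (hz x).2.1 hx),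
    (tsupport_indicator_subset_closedBall (fun x _ hx => (hz x).2.1 hx)).trans hΩ⟩

/-! ## §4 Values and derivatives along the cone -/

/-- **The cut-off on the cone**: `ζ (t • σ y) = (χ t · φ y) • g (t • σ y)` for `t > 0`. [folklore] -/
theorem coneCutoff_smul_sigma (hc : ∀ y, c y = 2 / (1 + ‖y‖ ^ 2))
    (hσ : ∀ y, σ y = !₂[c y * y 0, c y * y 1, c y - 1])
    (hπ : ∀ x, π x = (‖x‖ + x 2)⁻¹ • !₂[x 0, x 1]) (χ : ℝ → ℝ) (φ : EuclideanSpace ℝ (Fin 2) → ℝ)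
    (g : EuclideanSpace ℝ (Fin 3) → W) {t : ℝ} (ht : 0 < t) (y : EuclideanSpace ℝ (Fin 2)) :
    ({x : EuclideanSpace ℝ (Fin 3) | 0 < ‖x‖ + x 2}.indicator (fun x => (χ ‖x‖ * φ (π x)) • g x)) (t • σ y) =
      (χ t * φ y) • g (t • σ y) := by
  rw [indicator_of_mem (show t • σ y ∈ {x : EuclideanSpace ℝ (Fin 3) | 0 < ‖x‖ + x 2} from smul_sigma_mem_V hc hσ ht y),
    norm_smul_sigma hc hσ, abs_of_pos ht, pi_smul_sigma hc hσ hπ ht]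

/-- **Chain rule along the cone**: for `θ` differentiable at `t • σ y`,
`D(y ↦ θ (t • σ y))_y v = Dθ_{t•σ y} (t • Dσ_y v)`. [folklore] -/
theorem fderiv_comp_smul_sigma (hc : ∀ y, c y = 2 / (1 + ‖y‖ ^ 2))
    (hσ : ∀ y, σ y = !₂[c y * y 0, c y * y 1, c y - 1]) {θ : EuclideanSpace ℝ (Fin 3) → W} (t : ℝ)
    (y v : EuclideanSpace ℝ (Fin 2)) (hθ : DifferentiableAt ℝ θ (t • σ y)) :
    fderiv ℝ (fun y => θ (t • σ y)) y v = fderiv ℝ θ (t • σ y) (t • fderiv ℝ σ y v) := by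
  have hσd : DifferentiableAt ℝ σ y := (contDiff_sigma hc hσ).differentiable (by simp) y
  have h1 : DifferentiableAt ℝ (fun y => t • σ y) y := hσd.const_smul t
  rw [show (fun y => θ (t • σ y)) = θ ∘ (fun y => t • σ y) from rfl, fderiv_comp y hθ h1,
    ContinuousLinearMap.comp_apply, fderiv_fun_const_smul hσd]
  rfl

/-- **The pull-back of the standard scalar cut-off is `χ(t) · φ`**: for `t > 0`,
`(y ↦ ζ (t • σ y)) = χ t • φ` when `g ≡ 1`, so `Dζ_{t•σy} (t • Dσ_y v) = χ t · Dφ_y v`. [folklore] -/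
theorem fderiv_coneCutoff_smul_sigma (hc : ∀ y, c y = 2 / (1 + ‖y‖ ^ 2))
    (hσ : ∀ y, σ y = !₂[c y * y 0, c y * y 1, c y - 1])
    (hπ : ∀ x, π x = (‖x‖ + x 2)⁻¹ • !₂[x 0, x 1])
    {χ : ℝ → ℝ} (hχ : ContDiff ℝ ∞ χ) {a b : ℝ} (ha : 0 < a) (hχs : tsupport χ ⊆ Icc a b)
    {φ : EuclideanSpace ℝ (Fin 2) → ℝ} (hφ : ContDiff ℝ ∞ φ) (hφc : HasCompactSupport φ)
    {t : ℝ} (ht : 0 < t) (y v : EuclideanSpace ℝ (Fin 2)) :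
    fderiv ℝ ({x : EuclideanSpace ℝ (Fin 3) | 0 < ‖x‖ + x 2}.indicator (fun x => (χ ‖x‖ * φ (π x)) • (1 : ℝ)))
        (t • σ y) (t • fderiv ℝ σ y v) = χ t * fderiv ℝ φ y v := by
  set ζ := {x : EuclideanSpace ℝ (Fin 3) | 0 < ‖x‖ + x 2}.indicator (fun x => (χ ‖x‖ * φ (π x)) • (1 : ℝ)) with hζ
  have hζs : ContDiff ℝ ∞ ζ :=
    (isTestFunctionOn_coneCutoff hπ hχ ha hχs hφ hφc (g := fun _ => (1 : ℝ)) contDiffOn_const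
      (Ω := ⊤) (subset_univ _)).contDiff
  have h1 : (fun y' => ζ (t • σ y')) = fun y' => χ t * φ y' := by
    funext y'
    rw [hζ, coneCutoff_smul_sigma hc hσ hπ χ φ (fun _ => (1 : ℝ)) ht, smul_eq_mul, mul_one]
  have h2 := fderiv_comp_smul_sigma hc hσ t y v ((hζs.differentiable (by simp)) (t • σ y))
  rw [← h2, h1, fderiv_const_mul ((hφ.differentiable (by simp)) y)]
  rfl

end Summit.QuantumFields.YangMills.Theorems.PoincareLipschitzConeLinkCutoff

end
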